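import Literature.AlgebraicGeometry.Resolution.FormalNodeTripleBlowupCharts
import HarnessLib

/-!
# `WildQuotients.SummitReduction` (stmt-ResolutionOfSingularities-16324), line `FramePerfect`, skeleton v8:
# helper lemmas for stub `stub_pair_orbitBlowupCentreNew` (C3) — the residue field and the dimension
# at the new component of the blown-up formal node ring (de Jong 1996, 3.4, chart "`t₁ ≠ 0`")

Route `ResolutionOfSingularities/WildQuotients`, crux `SummitReduction`; worker file supporting the
registered stub `stub_pair_orbitBlowupCentreNew` of the line skeleton (v8, lead c4).

De Jong 1996, 3.4 (p. 64): "Chart "`t₁ ≠ 0`". — Here we get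
`A[u, v, u', v']/(u - t₁u', v - t₁v', u'v' - t₁^{n₁-2} t₂^{n₂} ⋯ t_r^{n_r})`. Again the situation is
rather clear. The "new" component `T̃` lying over `T` is given by `u' = v' = t₁ = 0`." The tree's
rendering of this chart computation for the formal model `M = k⟦u, v, T⟧/(uv - ∏ Tⱼ^{νⱼ})` blown up
along `𝔭 = (u, v, Tᵢ)` (`FormalNodeRing.blowup_triplePrime_singular_over_centre`,
`FormalNodeTripleBlowupCharts.lean`) records WHERE the codimension-`≤ 2` singular points of the
blow-up over `V(𝔭)` are (over the generic point `𝔭`, at most one). Over a field that is not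
algebraically closed two more pieces of the same sentence are needed downstream, and are proved here:

* `centreNew_exists_sub_algebraMap_mem_newPrime`, `centreNew_exists_sub_algebraMap_mem_map_newPrime` —
  **the new component is the graph `T̃ = {u' = v' = Tᵢ = 0} ≅ V(𝔭)`**: the chart ring `P[𝔓/Tᵢ]` is
  generated over `P = k⟦u, v, T⟧` by `u' = u/Tᵢ`, `v' = v/Tᵢ ∈ newPrime = (Tᵢ, u', v')`, so
  `P → P[𝔓/Tᵢ]/newPrime` is onto, and likewise for `M → M[𝔭/T̄ᵢ]/newPrime'` — in particular the
  residue field of the blow-up at the generic point of `T̃` is that of `M` at `𝔭` (no residue field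
  extension: the singular point of the exceptional conic is RATIONAL);
* `centreNew_two_le_ringKrullDim_localization_map_newPrime` — the local ring of the chart at
  `newPrime'` has dimension `≥ 2` (`ht newPrime ≥ 3` in the domain `P[𝔓/Tᵢ]`, and
  `M[𝔭/T̄ᵢ] ≅ P[𝔓/Tᵢ]/(g_T)` with `g_T ≠ 0`, Krull);
* `centreNew_blowup_triplePrime_residue` — the scheme-theoretic form over ANY blow-up
  `ρ : B → Spec M` along `𝔭` (charts `IsBlowup.exists_charts_of_span_range_eq`, Stacks 0804): a
  non-regular point `y` of `B` over `V(𝔭)` with `dim 𝒪_{B,y} ≤ 2` has `dim 𝒪_{B,y} ≥ 2`, and every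
  germ at `y` is, modulo `𝔪_y`, a fraction `ρ^*(a)/ρ^*(s)` of global functions `a, s ∈ M`, `s ∉ 𝔭`.
-/

set_option linter.dupNamespace false

noncomputable section

open CategoryTheory CategoryTheory.Limits AlgebraicGeometry TopologicalSpace
open Literature.AlgebraicGeometry.Resolution
open Literature.AlgebraicGeometry
open IsLocalRing DeJong1996.FormalNodeRing DeJong1996.TripleCentre

namespace Summit.ResolutionOfSingularities.ResolutionOfSingularities.Theorems

universe u

variable {k : Type u} [Field k] {m : ℕ} {ν : Fin m → ℕ} {i : Fin m}

/-! ## `P → P[𝔓/Tᵢ]/newPrime` and `M → M[𝔭/T̄ᵢ]/newPrime'` are onto -/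

/-- **Every element of the chart ring `P[𝔓/Tᵢ]` is a constant modulo `newPrime = (Tᵢ, u', v')`**:
`P[𝔓/Tᵢ]` is generated over `P = k⟦u, v, T⟧` by `u' = u/Tᵢ`, `v' = v/Tᵢ` (`blowupAlgebra.eval_surjective`,
Stacks 052P), which lie in `newPrime` ("`T̃` … is given by `u' = v' = t₁ = 0`": `T̃` is the graph
of `V(𝔓)`). [cite: DeJong1996, 3.4, p. 64] -/
theorem centreNew_exists_sub_algebraMap_mem_newPrime (γ : ChartRing k m i (centreSeq k m i 2)) :
    ∃ a : MvPowerSeries (Fin 2 ⊕ Fin m) k,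
      γ - algebraMap _ (ChartRing k m i (centreSeq k m i 2)) a ∈ newPrime k m i := by
  classical
  obtain ⟨F, rfl⟩ := blowupAlgebra.eval_surjective (centreSeq k m i) 2 γ
  induction F using MvPolynomial.induction_on with
  | C a =>
    refine ⟨a, ?_⟩
    rw [blowupAlgebra.eval_C, sub_self]
    exact Ideal.zero_mem _
  | add p q hp hq =>
    obtain ⟨a, ha⟩ := hp
    obtain ⟨b, hb⟩ := hq
    refine ⟨a + b, ?_⟩
    rw [map_add, map_add]
    convert Ideal.add_mem _ ha hb using 1
    ring
  | mul_X p j _ =>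
    refine ⟨0, ?_⟩
    rw [map_zero, sub_zero, map_mul, blowupAlgebra.eval_X]
    exact Ideal.mul_mem_left _ _ (frac_mem_chartIdeal k m i (Set.mem_univ j))

/-- **Every element of the chart `M[𝔭/T̄ᵢ]` of the blow-up of `M = k⟦u, v, T⟧/(uv - ∏ Tⱼ^{νⱼ})` along
`𝔭 = (u, v, Tᵢ)` is, modulo the prime `newPrime' = newPrime · M[𝔭/T̄ᵢ]` of the new component, the
image of an element of `M`** (`centreNew_exists_sub_algebraMap_mem_newPrime` pushed along the
surjection `P[𝔓/Tᵢ] ↠ M[𝔭/T̄ᵢ]`, `blowupAlgebra.mapQuotient_surjective`). Consequently the residue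
field of the blow-up at the generic point of the new component `T̃` is the residue field of `M`
at `𝔭`. [cite: DeJong1996, 3.4, p. 64] -/
theorem centreNew_exists_sub_algebraMap_mem_map_newPrime
    (γ : AChartRing k m ν i (centreSeq k m i 2)) :
    ∃ a : DeJong1996.FormalNodeRing k m ν,
      γ - algebraMap (DeJong1996.FormalNodeRing k m ν) (AChartRing k m ν i (centreSeq k m i 2)) a ∈
        (newPrime k m i).map (blowupAlgebra.mapQuotient (Ideal.span (Set.range (centreSeq k m i)))
          (centreSeq k m i 2) (Ideal.span {DeJong1996.formalNodeRelation k m ν})) := by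
  set mq := blowupAlgebra.mapQuotient (Ideal.span (Set.range (centreSeq k m i)))
    (centreSeq k m i 2) (Ideal.span {DeJong1996.formalNodeRelation k m ν}) with hmq
  obtain ⟨γ₀, rfl⟩ := blowupAlgebra.mapQuotient_surjective (Ideal.span (Set.range (centreSeq k m i)))
    (centreSeq k m i 2) (Ideal.span {DeJong1996.formalNodeRelation k m ν}) γ
  obtain ⟨a, ha⟩ := centreNew_exists_sub_algebraMap_mem_newPrime γ₀
  refine ⟨Ideal.Quotient.mk _ a, ?_⟩
  rw [← hmq, ← blowupAlgebra.mapQuotient_algebraMap, ← map_sub]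
  exact Ideal.mem_map_of_mem mq ha

/-! ## The local ring at the new component has dimension `≥ 2` -/

/-- **Height bookkeeping through `C/(f) ≅ B`** (Krull), the converse direction of the tree's
`Ideal.height_comap_comap_le_three`: for a non-zero `f` in a Noetherian domain `C`, an isomorphism
`e : C/(f) ≅ B` and a prime `𝔷` of `B` whose preimage `Q` in `C` has height `≥ 3`, the local ring
`B_𝔷 ≅ C_Q/(f)` has dimension `≥ 2` (`dim C_Q = dim C_Q/(f) + 1`). [cite: Matsumura1987, Thm. 14.2] -/
theorem centreNew_two_le_ringKrullDim_localization_of_three_le_height {C : Type u} [CommRing C]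
    [IsDomain C] [IsNoetherianRing C] {B : Type u} [CommRing B] {f : C} (hf : f ≠ 0)
    (e : (C ⧸ Ideal.span {f}) ≃+* B) (𝔷 : Ideal B) [𝔷.IsPrime]
    (h3 : (3 : ℕ∞) ≤ ((𝔷.comap e).comap (Ideal.Quotient.mk (Ideal.span {f}))).height) :
    (2 : WithBot ℕ∞) ≤ ringKrullDim (Localization.AtPrime 𝔷) := by
  set P' := 𝔷.comap e with hP'
  haveI : P'.IsPrime := Ideal.comap_isPrime _ _
  set Q := P'.comap (Ideal.Quotient.mk (Ideal.span {f})) with hQ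
  haveI hQp : Q.IsPrime := Ideal.comap_isPrime _ P'
  -- `B_𝔷 ≅ (C/(f))_{P'} ≅ C_Q/(f)`
  let ε : Localization.AtPrime P' ≃+* Localization.AtPrime 𝔷 :=
    IsLocalization.ringEquivOfRingEquiv (Localization.AtPrime P') (Localization.AtPrime 𝔷) e
      (e.map_primeCompl_comap_eq 𝔷)
  rw [← ringKrullDim_eq_of_ringEquiv ε]
  set CQ := Localization.AtPrime Q with hCQ
  haveI : IsDomain CQ :=
    IsLocalization.isDomain_of_le_nonZeroDivisors _ (Ideal.primeCompl_le_nonZeroDivisors Q)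
  have hf0 : algebraMap _ CQ f ≠ 0 := by
    intro h0
    apply hf
    have hinj : Function.Injective (algebraMap C CQ) :=
      IsLocalization.injective CQ (Ideal.primeCompl_le_nonZeroDivisors Q)
    rw [← map_zero (algebraMap C CQ)] at h0
    exact hinj h0
  have hfm : algebraMap _ CQ f ∈ maximalIdeal CQ := by
    rw [← Localization.AtPrime.map_eq_maximalIdeal]
    exact Ideal.mem_map_of_mem _ (mem_comap_mk_span_singleton f P')
  have hd := ringKrullDim_quotient_span_singleton_succ_eq_ringKrullDim_of_mem_nonZeroDivisors
    (mem_nonZeroDivisors_of_ne_zero hf0) hfm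
  have e₂ := localizationQuotientEquiv f P'
  rw [ringKrullDim_eq_of_ringEquiv e₂]
  change (2 : WithBot ℕ∞) ≤ ringKrullDim (CQ ⧸ Ideal.span {algebraMap C CQ f})
  -- arithmetic: `d + 1 = ht Q ≥ 3` gives `d ≥ 2`
  rw [IsLocalization.AtPrime.ringKrullDim_eq_height Q CQ] at hd
  set d := ringKrullDim (CQ ⧸ Ideal.span {algebraMap C CQ f}) with hddef
  have hQ3' : (((3 : ℕ∞)) : WithBot ℕ∞) ≤ d + 1 := by
    rw [hd]
    exact_mod_cast h3
  clear_value d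
  induction d using WithBot.recBotCoe with
  | bot => exact absurd hQ3' (by simp)
  | coe d =>
    have h1 : ((d + 1 : ℕ∞) : WithBot ℕ∞) = (d : WithBot ℕ∞) + 1 := by push_cast; rfl
    rw [← h1, WithBot.coe_le_coe] at hQ3'
    have h2 : (2 : ℕ∞) ≤ d := by
      induction d using ENat.recTopCoe with
      | top => exact le_top
      | coe d =>
        have : (3 : ℕ) ≤ d + 1 := by exact_mod_cast hQ3'
        exact_mod_cast (show 2 ≤ d by omega)
    exact (WithBot.coe_le_coe.mpr h2 : ((2 : ℕ∞) : WithBot ℕ∞) ≤ (d : WithBot ℕ∞))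

/-- **`dim M[𝔭/T̄ᵢ]_{newPrime'} ≥ 2`.** With `M[𝔭/T̄ᵢ] ≅ P[𝔓/Tᵢ]/(g_T)`
(`quotientStrictTransformTEquiv`), `g_T ≠ 0` in the domain `P[𝔓/Tᵢ]`, and `Q ⊇ newPrime` the
preimage of `newPrime'`: `dim P[𝔓/Tᵢ]_Q = dim P[𝔓/Tᵢ]_Q/(g_T) + 1` (Krull) and `ht Q ≥ ht newPrime ≥ 3`
(`three_le_height_newPrime`). [cite: DeJong1996, 3.4, p. 64] -/
theorem centreNew_two_le_ringKrullDim_localization_map_newPrime (hν : 2 ≤ ν i)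
    (𝔷 : Ideal (AChartRing k m ν i (centreSeq k m i 2))) [𝔷.IsPrime]
    (h𝔷 : 𝔷 = (newPrime k m i).map (blowupAlgebra.mapQuotient (Ideal.span (Set.range (centreSeq k m i)))
      (centreSeq k m i 2) (Ideal.span {DeJong1996.formalNodeRelation k m ν}))) :
    (2 : WithBot ℕ∞) ≤ ringKrullDim (Localization.AtPrime 𝔷) := by
  classical
  let mq := blowupAlgebra.mapQuotient (Ideal.span (Set.range (centreSeq k m i)))
    (centreSeq k m i 2) (Ideal.span {DeJong1996.formalNodeRelation k m ν})
  let e := quotientStrictTransformTEquiv (k := k) (m := m) (ν := ν) (i := i) hν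
  have he : ∀ g : ChartRing k m i (centreSeq k m i 2), e (Ideal.Quotient.mk _ g) = mq g := fun g => rfl
  -- the preimage `Q ⊇ newPrime` of `𝔷`
  obtain ⟨Q, hQdef⟩ : ∃ Q : Ideal (ChartRing k m i (centreSeq k m i 2)),
      Q = (𝔷.comap e).comap (Ideal.Quotient.mk (Ideal.span {strictTransformT k m ν i})) := ⟨_, rfl⟩
  have hle : newPrime k m i ≤ Q := by
    intro x hx
    rw [hQdef]
    simp only [Ideal.mem_comap]
    show e (Ideal.Quotient.mk _ x) ∈ 𝔷
    rw [he, h𝔷]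
    exact Ideal.mem_map_of_mem mq hx
  have hQ3 : (3 : ℕ∞) ≤ Q.height := (three_le_height_newPrime k m i).trans (Ideal.height_mono hle)
  rw [hQdef] at hQ3
  exact centreNew_two_le_ringKrullDim_localization_of_three_le_height (strictTransformT_ne_zero hν)
    e 𝔷 hQ3

/-- Localization bookkeeping: if `ℓ = γ/τ` in `C_P` and `γ ≡ a`, `τ ≡ s` modulo `P`, then
`ℓ · s - a ∈ 𝔪_{C_P}` (multiply by the unit `τ`: `γ s - a τ = (γ - a) s - a (τ - s) ∈ P`). [folklore] -/
theorem centreNew_mul_sub_mem_maximalIdeal_of_mk'_eq {C L : Type u} [CommRing C] [CommRing L]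
    [Algebra C L] (P : Ideal C) [P.IsPrime] [IsLocalization.AtPrime L P] [IsLocalRing L]
    {ℓ : L} {γ : C} {τ : P.primeCompl} (hℓ : IsLocalization.mk' L γ τ = ℓ) {a s : C}
    (ha : γ - a ∈ P) (hs : (τ : C) - s ∈ P) :
    ℓ * algebraMap C L s - algebraMap C L a ∈ maximalIdeal L := by
  set E : L := ℓ * algebraMap C L s - algebraMap C L a with hE
  have hu : IsUnit (algebraMap C L (τ : C)) := IsLocalization.map_units L τ
  have hprod : E * algebraMap C L (τ : C) ∈ maximalIdeal L := by
    have h1 : E * algebraMap C L (τ : C) = algebraMap C L (γ * s - a * τ) := by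
      rw [hE, ← hℓ, sub_mul, mul_right_comm, IsLocalization.mk'_spec, map_sub, map_mul, map_mul]
    rw [h1, IsLocalization.AtPrime.to_map_mem_maximal_iff L P]
    have h2 : γ * s - a * τ = (γ - a) * s - a * ((τ : C) - s) := by ring
    rw [h2]
    exact Ideal.sub_mem _ (Ideal.mul_mem_right _ _ ha) (Ideal.mul_mem_left _ _ hs)
  obtain ⟨u, hu'⟩ := hu
  have : E = E * algebraMap C L (τ : C) * ↑u⁻¹ := by
    rw [← hu', mul_assoc, Units.mul_inv, mul_one]
  rw [this]
  exact Ideal.mul_mem_right _ _ hprod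

/-! ## The scheme-theoretic form over a blow-up of `Spec M` along `𝔭` -/

set_option maxHeartbeats 4000000 in
open Scheme.IdealSheafData in
/-- **de Jong 1996, 3.4, chart "`t₁ ≠ 0`", over any field: at the generic point of the new
component the blow-up has dimension `2` and NO residue field extension over `𝔭`.** For `νᵢ ≥ 2`
and any blow-up `ρ : B → Spec M` of `M = k⟦u, v, T⟧/(uv - ∏ Tⱼ^{νⱼ})` along the ideal sheaf of
`𝔭 = (u, v, Tᵢ)`, a point `y ∈ B` over `V(𝔭)` at which `B` is not regular and with `dim 𝒪_{B,y} ≤ 2`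
(by `FormalNodeRing.blowup_triplePrime_singular_over_centre` it lies over `𝔭` and is unique; it is the
generic point of `T̃ = {u' = v' = Tᵢ = 0}` in the chart `Tᵢ ≠ 0`) satisfies: `dim 𝒪_{B,y} ≥ 2`
(`centreNew_two_le_ringKrullDim_localization_map_newPrime`), and every germ `c ∈ 𝒪_{B,y}` is
congruent modulo `𝔪_y` to a fraction of pulled-back global functions: `c · ρ^*(s) ≡ ρ^*(a)` with
`a, s ∈ M`, `s ∉ 𝔭` (`centreNew_exists_sub_algebraMap_mem_map_newPrime` in the local ring
`M[𝔭/T̄ᵢ]_{newPrime'} ≅ 𝒪_{B,y}` of the chart, Stacks 0804 / `IsBlowup.exists_charts_of_span_range_eq`).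
[cite: DeJong1996, 3.4 Claim (iii), p. 64] -/
theorem centreNew_blowup_triplePrime_residue (k : Type u) [Field k] (m : ℕ) (ν : Fin m → ℕ)
    (i : Fin m) (hν : 2 ≤ ν i) (B : Scheme.{u})
    (ρ : B ⟶ Spec (.of (DeJong1996.FormalNodeRing k m ν)))
    (hρ : IsBlowup ρ (ofIdealTop ((triplePrime k m ν i).map
      (Scheme.ΓSpecIso (.of (DeJong1996.FormalNodeRing k m ν))).inv.hom))) :
    ∀ y : B, triplePrime k m ν i ≤ (ρ y).asIdeal →
      ¬ IsRegularLocalRing (B.presheaf.stalk y) → ringKrullDim (B.presheaf.stalk y) ≤ 2 →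
        (ρ y).asIdeal = triplePrime k m ν i ∧
        (2 : WithBot ℕ∞) ≤ ringKrullDim (B.presheaf.stalk y) ∧
        ∀ c : B.presheaf.stalk y, ∃ a s : DeJong1996.FormalNodeRing k m ν,
          s ∉ triplePrime k m ν i ∧
          c * (B.presheaf.germ ⊤ y trivial).hom (ρ.appTop.hom
              ((Scheme.ΓSpecIso (.of (DeJong1996.FormalNodeRing k m ν))).inv.hom s)) -
            (B.presheaf.germ ⊤ y trivial).hom (ρ.appTop.hom
              ((Scheme.ΓSpecIso (.of (DeJong1996.FormalNodeRing k m ν))).inv.hom a)) ∈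
            maximalIdeal (B.presheaf.stalk y) := by
  classical
  -- notation: `M`, the centre `𝔭 = 𝔓 M` and its three generators
  set M := DeJong1996.FormalNodeRing k m ν with hM
  set mk := Ideal.Quotient.mk (Ideal.span {DeJong1996.formalNodeRelation k m ν}) with hmk
  set 𝔭 : Ideal M := (Ideal.span (Set.range (centreSeq k m i))).map mk with h𝔭
  have h𝔭t : triplePrime k m ν i = 𝔭 := (map_span_range_centreSeq k m ν i).symm
  rw [h𝔭t] at hρ ⊢
  let g : Fin 3 → M := fun j => mk (centreSeq k m i j)
  have hg : Ideal.span (Set.range g) = 𝔭 := by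
    rw [h𝔭, Ideal.map_span, ← Set.range_comp]
    rfl
  obtain ⟨φ, hφo, hcov, hφρ⟩ := hρ.exists_charts_of_span_range_eq g hg
  have hρφ : ∀ (j : Fin 3) (w : Spec (.of (blowupAlgebra 𝔭 (g j)))),
      (ρ (φ j w)).asIdeal = w.asIdeal.comap (algebraMap M (blowupAlgebra 𝔭 (g j))) := by
    intro j w
    rw [← Scheme.Hom.comp_apply, hφρ j, Spec.map_apply]
    rfl
  -- a singular point of `B` lies in the chart `Tᵢ ≠ 0`, at the prime `newPrime · M[𝔭/T̄ᵢ]`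
  set 𝔮 : Ideal (blowupAlgebra 𝔭 (g 2)) := (newPrime k m i).map (blowupAlgebra.mapQuotient
    (Ideal.span (Set.range (centreSeq k m i))) (centreSeq k m i 2)
      (Ideal.span {DeJong1996.formalNodeRelation k m ν})) with h𝔮
  have key : ∀ y : B, 𝔭 ≤ (ρ y).asIdeal → ¬ IsRegularLocalRing (B.presheaf.stalk y) →
      ringKrullDim (B.presheaf.stalk y) ≤ 2 →
        ∃ z : Spec (.of (blowupAlgebra 𝔭 (g 2))), φ 2 z = y ∧ z.asIdeal = 𝔮 ∧
          (ρ y).asIdeal = 𝔭 := by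
    intro y hy hsing hdim
    obtain ⟨j, z, rfl⟩ := hcov y
    haveI := hφo j
    have hz : ¬ IsRegularLocalRing (Localization.AtPrime z.asIdeal) :=
      not_isRegularLocalRing_localization_of_stalk (φ j) z hsing
    have hj : j = 0 ∨ j = 1 ∨ j = 2 := by
      rcases j with ⟨j, hj⟩
      have : j = 0 ∨ j = 1 ∨ j = 2 := by omega
      rcases this with h | h | h
      · exact Or.inl (Fin.ext h)
      · exact Or.inr (Or.inl (Fin.ext h))
      · exact Or.inr (Or.inr (Fin.ext h))
    rcases hj with rfl | rfl | rfl
    · -- chart `u ≠ 0`: regular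
      have hreg : IsRegularRing (blowupAlgebra 𝔭 (g 0)) :=
        isRegularRing_aChartRing_zero (k := k) (m := m) (ν := ν) (i := i) hν
      exact absurd (@IsRegularRing.isRegularLocalRing_localization _ _ hreg z.asIdeal z.isPrime) hz
    · -- chart `v ≠ 0`: regular
      have hreg : IsRegularRing (blowupAlgebra 𝔭 (g 1)) :=
        isRegularRing_aChartRing_one (k := k) (m := m) (ν := ν) (i := i) hν
      exact absurd (@IsRegularRing.isRegularLocalRing_localization _ _ hreg z.asIdeal z.isPrime) hz
    · -- chart `Tᵢ ≠ 0`
      have hT : algebraMap M (blowupAlgebra 𝔭 (g 2)) (mk (centreSeq k m i 2)) ∈ z.asIdeal := by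
        rw [← Ideal.mem_comap, ← hρφ]
        exact hy (Ideal.mem_map_of_mem _ (centreSeq_mem k m i 2))
      have hdim' : ringKrullDim (Localization.AtPrime z.asIdeal) ≤ 2 := by
        rw [ringKrullDim_localization_eq_of_stalk (φ 2) z]; exact hdim
      obtain ⟨hz𝔮, hcomap⟩ :=
        AChart.eq_map_newPrime_and_comap_eq (k := k) (m := m) (ν := ν) (i := i) hν z.asIdeal hz hT hdim'
      refine ⟨z, rfl, hz𝔮, ?_⟩
      rw [hρφ, hcomap, h𝔭t]
  intro y hy hsing hdim
  obtain ⟨z, rfl, hz, h𝔭y⟩ := key y hy hsing hdim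
  haveI := hφo 2
  refine ⟨h𝔭y, ?_, ?_⟩
  · -- ### dimension `≥ 2`
    rw [← ringKrullDim_localization_eq_of_stalk (φ 2) z]
    haveI : z.asIdeal.IsPrime := z.isPrime
    exact centreNew_two_le_ringKrullDim_localization_map_newPrime hν z.asIdeal hz
  · -- ### the residue field: read in `C_𝔮 ≅ 𝒪_{B, φ₂ z}`
    let C := blowupAlgebra 𝔭 (g 2)
    let alg : M →+* C := algebraMap M C
    let L := Localization.AtPrime z.asIdeal
    let eL : (Spec (.of C)).presheaf.stalk z ≅ .of L := Spec.stalkIso (.of C) z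
    let T : B.presheaf.stalk (φ 2 z) →+* L := eL.hom.hom.comp ((φ 2).stalkMap z).hom
    -- `T ∘ ρ^* = C_𝔮 ← C ← M`, as morphisms `M ⟶ L`
    have h3 : ρ.appTop ≫ (φ 2).appTop = (Spec.map (CommRingCat.ofHom alg)).appTop := by
      rw [← Scheme.Hom.comp_appTop]
      exact congrArg Scheme.Hom.appTop (hφρ 2)
    have hTm : (Scheme.ΓSpecIso (.of M)).inv ≫ ρ.appTop ≫ B.presheaf.germ ⊤ (φ 2 z) trivial ≫
        (φ 2).stalkMap z ≫ eL.hom = CommRingCat.ofHom alg ≫ CommRingCat.ofHom (algebraMap C L) := by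
      rw [Scheme.Hom.germ_stalkMap_assoc (φ 2) ⊤ z trivial]
      change (Scheme.ΓSpecIso (.of M)).inv ≫ ρ.appTop ≫ (φ 2).appTop ≫
        (Spec (.of C)).presheaf.germ ⊤ z trivial ≫ eL.hom = _
      rw [← Category.assoc ρ.appTop, h3, ← Scheme.ΓSpecIso_inv_naturality_assoc,
        Spec.germ_stalkMapIso_hom, Iso.inv_hom_id_assoc]
    have hT : ∀ p : M, T ((B.presheaf.germ ⊤ (φ 2 z) trivial).hom (ρ.appTop.hom
        ((Scheme.ΓSpecIso (.of M)).inv.hom p))) = algebraMap C L (alg p) := by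
      intro p
      have h1 := congrArg (fun f => f.hom p) hTm
      simp only [CommRingCat.hom_comp, CommRingCat.hom_ofHom, RingHom.comp_apply] at h1
      exact h1
    -- `𝔮 ∩ M = 𝔭`
    have hcomap : z.asIdeal.comap alg = 𝔭 := by rw [← hρφ]; exact h𝔭y
    -- pulling back non-units along `T`
    have hTmax : ∀ x : B.presheaf.stalk (φ 2 z), T x ∈ maximalIdeal L →
        x ∈ maximalIdeal (B.presheaf.stalk (φ 2 z)) := fun x hx =>
      (IsLocalRing.mem_maximalIdeal x).mpr (mem_nonunits_iff.mpr fun hu =>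
        (mem_nonunits_iff.mp ((IsLocalRing.mem_maximalIdeal _).mp hx)) (hu.map T))
    intro c
    obtain ⟨⟨γ, τ⟩, hγτ₀⟩ := IsLocalization.mk'_surjective z.asIdeal.primeCompl (T c)
    have hγτ : IsLocalization.mk' L γ τ = T c := hγτ₀
    obtain ⟨a, ha⟩ := centreNew_exists_sub_algebraMap_mem_map_newPrime (k := k) (ν := ν) (i := i) γ
    obtain ⟨s, hs⟩ := centreNew_exists_sub_algebraMap_mem_map_newPrime (k := k) (ν := ν) (i := i) (τ : C)
    rw [← h𝔮, ← hz] at ha hs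
    have hs𝔭 : s ∉ 𝔭 := by
      intro hs𝔭
      have h1 : alg s ∈ z.asIdeal := by rw [← Ideal.mem_comap, hcomap]; exact hs𝔭
      have h2 : (τ : C) ∈ z.asIdeal := by
        have := Ideal.add_mem _ hs h1
        rwa [sub_add_cancel] at this
      exact τ.2 h2
    refine ⟨a, s, hs𝔭, hTmax _ ?_⟩
    haveI : IsLocalRing L := IsLocalization.AtPrime.isLocalRing L z.asIdeal
    have ha' : γ - alg a ∈ z.asIdeal := ha
    have hs' : (τ : C) - alg s ∈ z.asIdeal := hs
    have hEmax := centreNew_mul_sub_mem_maximalIdeal_of_mk'_eq (C := C) (L := L) z.asIdeal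
      (ℓ := T c) (γ := γ) (τ := τ) hγτ (a := alg a) (s := alg s) ha' hs'
    have key3 : ∀ (x y : B.presheaf.stalk (φ 2 z)) (x' y' : L), T x = x' → T y = y' →
        T c * x' - y' ∈ maximalIdeal L → T (c * x - y) ∈ maximalIdeal L := by
      intro x y x' y' hx hy h
      rw [map_sub, map_mul, hx, hy]
      exact h
    exact key3 _ _ _ _ (hT s) (hT a) hEmax

end Summit.ResolutionOfSingularities.ResolutionOfSingularities.Theorems

end
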